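import Summits.ResolutionOfSingularities.ResolutionOfSingularities.Theorems.FrobeniusClosingSteerWords27ToricExitWords
import Summits.ResolutionOfSingularities.ResolutionOfSingularities.Theorems.FrobeniusClosingSteerWords28NoTangentialStep
import Summits.ResolutionOfSingularities.ResolutionOfSingularities.Theorems.FrobeniusClosingSteerPointTailChainOut

/-!
# Crux `Steer` (stmt-ResolutionOfSingularities-16345), line `switching-dichotomy` — WORDS 29: §σ2.28 (e2) `PointTailPersistTwoN` HOLDS (adoption leaf, res-D-pv-011) and its glue (HOIST of the registered skeleton r52 5a09c4c2f84a0135, l.1675–1946, inside `section HeightSplitTwo` with its `variable {K : Type} [Field K]`)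

Holder res-L0-w41-lead-1 g6 on res-L0-w41-plan-1 RULING 47 (E1) / 104b; see `…Words01Core` for the hoist protocol (bodies byte for byte;
`[cite: …]` / `[folklore]` tags on CLOSED `def … : Prop` words are written «(ref. …)» / «(folklore)» — GATE NOTE of `…Words02Stubs`;
cite keys inside `[cite:]` tags normalised to `references.bib` keys where needed, as in `…Words03Phases`).
Nothing here is a statement of the manuscript [claim: Hironaka2017, status: under-review]. OURS (candidates / vocabulary; AI review is
weaker than expert review).
-/

open Summit.ResolutionOfSingularities.ResolutionOfSingularities.Theses.FrobeniusClosing (IsolatedForcedTermination)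
open Literature.AlgebraicGeometry.Resolution (IsAbhyankarPlace FGOver exists_ringKrullDim_eq_and_trdeg_eq
  trdeg_eq_trdeg_of_isFractionRing locAtCentre IsQuadraticTransformAlong SubringDominates IsRsopPart
  LocalUniformization3 RelLocalUniformization CossartPiltant2019General)
open Summit.ResolutionOfSingularities.ResolutionOfSingularities.Theorems.SteerRankThinness
  (HasProperCoarsening concl_of_hasProperCoarsening rankOne_of_not_hasProperCoarsening)
open Summit.ResolutionOfSingularities.ResolutionOfSingularities.Theorems.PfaffLine

set_option linter.dupNamespace false

namespace Summit.ResolutionOfSingularities.ResolutionOfSingularities.Theorems.SwitchingDichotomy.Words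

section SteeredTwo

open IsLocalRing
open Literature.AlgebraicGeometry.Resolution (IsLocalBlowupAlong IsQuadraticTransform IsExcellentRing)

variable {K : Type} [Field K]


/-! #### §σ2.28 (e2) — `PointTailPersistTwoN` HOLDS (adoption leaf, res-D-pv-011; res-L0-w41-plan-1 RULING 117c; strat-2 recipe 12:15:22Z)

INSERTION RECIPE (holder only): imports `…Theorems.FrobeniusClosingSteerPointTailChainOut`, `…Theorems.FrobeniusClosingSteerMembersPerfectResidue`,
`…Theorems.FrobeniusClosingSteerMemberDerivationsEFT`; paste right before `strippingTailIsolatedConclTwoN_of_persist`. New name only: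
`pointTailPersistTwoN_holds`. 0 sorries. Tree: p526785 · p527601 · p528265 · p530746 (`exists_strippedChain_of_thread_out`) ·
`…PointTailChainOut` (`PointTail.exists_chainHP_of_pointTail`) · pv-004 (L7) p528709 · 062 `OddBranchPersistence.weakPersistence_of_pointSteps` p528129. -/

/-- **(e2) · `PointTailPersistTwoN` HOLDS.** Package the point steps of the F-B♮ tail into the exposed K♭HP(2,4) chain
(`PointTail.exists_chainHP_of_pointTail`: members `S m = R (j (m+1))`, `x m` = exceptional parameter of the point step `j (m+1)`, H from (L7),
perfect residue fields from ZeroDim); (e1) `NoTangentialTailHP 2 4` on that chain makes `x m` and `x (m+1)` associates in `S (m+2) ⊆ O` for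
`m ≥ m₀`, so `v (x m) = v (x m₀)` (units of a dominated member have value `1`); hence `x m₀` is an exceptional parameter of EVERY later point step
(least value on `𝔪 = P`), and res-type-062's `OddBranchPersistence.weakPersistence_of_pointSteps` yields the weak persistence clause. OURS.
[folklore] -/
theorem pointTailPersistTwoN_holds : PointTailPersistTwoN := by
  intro p hp2 k K _ _ _ _ _ O A₀ h₀ t core hnc R P s hR0 hN hrun hnd hhigh h2fin hposinf hiso hNT hrec
  subst hp2
  haveI : Fact (Nat.Prime 2) := ⟨Nat.prime_two⟩
  haveI : CharP K 2 := charP_of_injective_algebraMap (algebraMap k K).injective 2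
  obtain ⟨hfg, htp, hfr, hreg, -, hzd, -, -, -, -, -, -, htr, -⟩ := core
  have hmono : Monotone R := hrun.monotone
  obtain ⟨-, hstep⟩ := hrun
  have hsp : ∀ i, s i ^ 2 ∈ R i := fun i => by
    obtain ⟨_, hs, -⟩ := hstep i
    exact hs
  have hbl : ∀ i, IsLocalBlowupAlong O (R i) (P i) (R (i + 1)) := fun i => by
    obtain ⟨_, _, -, hbl, -⟩ := hstep i
    exact hbl
  have h0 : IsRegularLocalRing (R 0) := by
    rw [hR0]
    exact (Literature.AlgebraicGeometry.Resolution.isRegularLocalRing_locAtCentre_iff h₀).mpr hreg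
  have hregR : ∀ i, IsRegularLocalRing (R i) := fun i =>
    _root_.Summit.ResolutionOfSingularities.ResolutionOfSingularities.Theorems.SwitchingDichotomy.SteeredMembersRegular.isRegularLocalRing_steps (O := O) R P i h0 (fun j _ => by
      obtain ⟨hloc, hs, hσ, hblj, -⟩ := hstep j
      refine ⟨hloc, ?_, hblj⟩
      rcases hσ with hperm | ⟨hP, -, -⟩
      · exact Or.inl hperm.2.2.1
      · exact Or.inr hP) i le_rfl
  haveI hlocR : ∀ i, IsLocalRing (R i) := fun i => by haveI := hregR i; infer_instance
  have hdim : ∀ i, ringKrullDim (R i) = (4 : ℕ) := fun i =>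
    _root_.Summit.ResolutionOfSingularities.ResolutionOfSingularities.Theorems.SwitchingDichotomy.TailCodim.ringKrullDim_member_eq
      k K O A₀ h₀ t two_pos hfg htp hfr hzd htr R i hR0 fun j _ => (hbl j).isLocalBlowup
  -- members are dominated by `O`
  have hRO0 : R 0 ≤ O.toSubring := by rw [hR0]; exact Literature.AlgebraicGeometry.Resolution.locAtCentre_le h₀
  have hloc0 : Literature.AlgebraicGeometry.Resolution.locAtCentre (R 0) O = R 0 := by
    rw [hR0, Literature.AlgebraicGeometry.Resolution.locAtCentre_locAtCentre]
  have hrunO := _root_.Summit.ResolutionOfSingularities.ResolutionOfSingularities.Theorems.SwitchingDichotomy.NoSingularCarrier.le_and_locAtCentre_eq_of_run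
    R P hRO0 hloc0 hbl
  have hval : ∀ i (a : R i), a ∈ IsLocalRing.maximalIdeal (R i) ↔ O.valuation (a : K) < 1 := fun i =>
    _root_.Summit.ResolutionOfSingularities.ResolutionOfSingularities.Theorems.SwitchingDichotomy.NoSingularCarrier.mem_maximalIdeal_iff_of_locAtCentre_eq
      (hrunO i).1 (hrunO i).2
  -- ### σ-data at the positive steps: prime and singular
  have hvis : ∀ i, (∃ _ : IsLocalRing (R i), P i ≠ IsLocalRing.maximalIdeal (R i)) →
      (P i).IsPrime ∧
      (∀ _ : (P i).IsPrime, ¬ IsRegularLocalRing (AdjoinRoot ((Polynomial.X : Polynomial (Localization.AtPrime (P i))) ^ 2 -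
          Polynomial.C (algebraMap (R i) (Localization.AtPrime (P i)) ⟨s i ^ 2, hsp i⟩)))) := by
    intro i ⟨_, hne⟩
    obtain ⟨hloc, hs, hσ, -, -⟩ := hstep i
    have hperm : IsPermissibleCentre (R i) 2 ⟨s i ^ 2, hsp i⟩ (P i) := by
      rcases hσ with hperm | ⟨hP, -, -⟩
      · exact hperm
      · exact absurd hP hne
    obtain ⟨hPi, hsing, -, -⟩ := hperm.2.1
    exact ⟨hPi, fun _ => hsing⟩
  -- ### the tail clauses
  have hpt : ∀ i₀ : ℕ, ∃ i, i₀ ≤ i ∧ ∃ _ : IsLocalRing (R i), P i = IsLocalRing.maximalIdeal (R i) := by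
    intro i₀
    obtain ⟨i, hi, hpt⟩ := hrec i₀
    exact ⟨i, hi, hpt⟩
  have hpos : ∀ i₀ : ℕ, ∃ i, i₀ ≤ i ∧ ∃ _ : IsLocalRing (R i), P i ≠ IsLocalRing.maximalIdeal (R i) := by
    intro i₀
    obtain ⟨i, hi, hi₀⟩ := hposinf.exists_gt i₀
    exact ⟨i, hi₀.le, hi⟩
  have hfin2 : ∃ m₀ : ℕ, ∀ m, m₀ ≤ m → (∃ _ : IsLocalRing (R m), P m ≠ IsLocalRing.maximalIdeal (R m)) → (P m).height ≤ 1 := by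
    have hfin : {j | IsPosStepTwo R P j}.Finite := Set.not_infinite.mp h2fin
    obtain ⟨m₀, hm₀⟩ := hfin.bddAbove
    refine ⟨m₀ + 1, fun m hm hposm => ?_⟩
    by_contra hgt
    have h2 : 2 ≤ (P m).height := by
      rw [not_le] at hgt
      exact Order.add_one_le_of_lt hgt
    have : m ≤ m₀ := hm₀ ⟨hposm, h2⟩
    omega
  have hmult : ∃ i₀ : ℕ, ∀ i, i₀ ≤ i → (∃ _ : IsLocalRing (R i), P i = IsLocalRing.maximalIdeal (R i)) →
      ∃ g : R i, (⟨s i ^ 2, hsp i⟩ : R i) - g ^ 2 ∈ P i ^ 2 := by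
    obtain ⟨i₀, hi₀⟩ := hhigh
    refine ⟨i₀, fun i hi ⟨_, hP⟩ => ?_⟩
    obtain ⟨_, hs, g, hg⟩ := hi₀ i hi
    refine ⟨g, ?_⟩
    rw [hP]
    exact Ideal.pow_le_pow_right (by norm_num) hg
  have hiso' : ∃ i₀ : ℕ, ∀ i, i₀ ≤ i → (∃ _ : IsLocalRing (R i), P i = IsLocalRing.maximalIdeal (R i)) →
      ∀ (Q : Ideal (AdjoinRoot ((Polynomial.X : Polynomial (R i)) ^ 2 - Polynomial.C (⟨s i ^ 2, hsp i⟩ : R i)))) [Q.IsPrime],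
        (∃ Q' : Ideal (AdjoinRoot ((Polynomial.X : Polynomial (R i)) ^ 2 - Polynomial.C (⟨s i ^ 2, hsp i⟩ : R i))),
          Q'.IsPrime ∧ Q < Q') → IsRegularLocalRing (Localization.AtPrime Q) := by
    obtain ⟨i₀, hi₀⟩ := hiso
    refine ⟨i₀, fun i hi hpt Q hQp hQ => ?_⟩
    obtain ⟨hs, hisol⟩ := hi₀ i hi hpt
    exact hisol Q hQ
  -- ### H for the members ((L7), res-D-pv-004) and perfect residue fields (ZeroDim)
  have hH : ∀ (i : ℕ) (T : Subring K) [IsLocalRing T], T = R i → ∀ f g : T,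
      (∀ N : ℕ, (∀ h : T, f - h ^ 2 ∉ IsLocalRing.maximalIdeal T ^ (N + 1)) → f - g ^ 2 ∈ IsLocalRing.maximalIdeal T ^ N →
        ∃ D : Derivation ℤ T T, D f ∉ IsLocalRing.maximalIdeal T ^ N ∨
          ((∀ y ∈ IsLocalRing.maximalIdeal T, D y ∈ IsLocalRing.maximalIdeal T) ∧ D f ∉ IsLocalRing.maximalIdeal T ^ (N + 1))) := by
    intro i T _ hT f g
    subst hT
    obtain ⟨A₁, -, -, hfg₁, hRA₁⟩ :=
      _root_.Summit.ResolutionOfSingularities.ResolutionOfSingularities.Theorems.SwitchingDichotomy.SteeredExit.exists_model_of_tower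
        O A₀ h₀ hfg hR0 (N := i) fun l _ => (hbl l).isLocalBlowup
    haveI := hregR i
    have hS : ∀ z : K, z ∈ R i ↔ ∃ a b : R i, b ∉ IsLocalRing.maximalIdeal (R i) ∧ z = (a : K) / b := by
      intro z
      constructor
      · intro hz
        refine ⟨⟨z, hz⟩, 1, fun h => ?_, by simp⟩
        exact (IsLocalRing.maximalIdeal.isMaximal (R i)).ne_top (Ideal.eq_top_of_isUnit_mem _ h isUnit_one)
      · rintro ⟨a, b, hb, rfl⟩
        have hbu : IsUnit b := by
          by_contra h
          exact hb ((IsLocalRing.mem_maximalIdeal b).mpr h)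
        obtain ⟨-, hbinv⟩ := (Literature.AlgebraicGeometry.Resolution.isUnit_subring_iff_inv_mem b).mp hbu
        rw [div_eq_mul_inv]
        exact (R i).mul_mem a.2 hbinv
    letI : Algebra k (R i) := ((algebraMap k K).codRestrict (R i)
      (_root_.Summit.ResolutionOfSingularities.ResolutionOfSingularities.Theorems.SwitchingDichotomy.GeoDict.algebraMap_mem_of_locChar
        O A₁ hRA₁ hS)).toAlgebra
    have hcompat : ∀ c : k, ((algebraMap k (R i) c : R i) : K) = algebraMap k K c := fun c => rfl
    haveI : Algebra.EssFiniteType k (R i) :=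
      _root_.Summit.ResolutionOfSingularities.ResolutionOfSingularities.Theorems.SwitchingDichotomy.GeoDict.essFiniteType_of_locChar
        O A₁ hRA₁ hS hfg₁ hcompat
    have h := _root_.Summit.ResolutionOfSingularities.ResolutionOfSingularities.Theorems.SwitchingDichotomy.MemberDerivations.hasCleaningDerivations_of_essFiniteType_perfect
      2 (R i) hcompat f g
    unfold _root_.Summit.ResolutionOfSingularities.ResolutionOfSingularities.Theorems.SwitchingDichotomy.MemberDerivations.HasCleaningDerivations at h
    exact h
  have hperf : ∀ (i : ℕ) (T : Subring K) [IsLocalRing T], T = R i → PerfectField (IsLocalRing.ResidueField T) := by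
    intro i T _ hT
    subst hT
    exact _root_.Summit.ResolutionOfSingularities.ResolutionOfSingularities.Theorems.SwitchingDichotomy.MembersPerfectResidue.perfectField_residueField_of_steps
      O A₀ h₀ hzd R P i hR0 fun l _ => hbl l
  -- ### the exposed chain
  obtain ⟨j, hjmono, hjP, -, S, hSloc, hle, f, g, x, e, he, hinf', hregS, hexc, hdimS, hqt, hspan, hlaw, hmultS, hHS,
      hperfS, hisoS, hSR, hxout⟩ :=
    _root_.Summit.ResolutionOfSingularities.ResolutionOfSingularities.Theorems.SwitchingDichotomy.PointTail.exists_chainHP_of_pointTail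
      2 O A₀ h₀ hfg R P s 4 hR0 hbl (fun i => by obtain ⟨_, _, -, -, hst⟩ := hstep i; exact hst) hsp hregR hdim
      hvis hpt hpos hfin2 hmult hiso'
      (fun S S' _ _ hle hqt ξ hξ hspan f G F hf hG hF e he hlaw =>
        _root_.Summit.ResolutionOfSingularities.ResolutionOfSingularities.Theorems.SwitchingDichotomy.CleanerDescent.cleaner_descent
          2 hle hqt hξ hspan hf hG hF he hlaw)
      hH hperf
  -- ### (e1) on the chain: the exceptional parameters are eventually associates
  obtain ⟨m₀, hm₀⟩ := hNT K S hle f g x e he hinf' hregS hexc hdimS hqt hspan hlaw hmultS hHS hperfS hisoS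
  -- from `m₀` on the values of the exceptional parameters agree
  have hxv : ∀ m, m₀ ≤ m → O.valuation ((x (m + 1) : S (m + 2)) : K) = O.valuation ((x m : S (m + 1)) : K) := by
    intro m hm
    have hspan_eq := hm₀ m hm
    haveI : IsDomain (S (m + 2)) := inferInstance
    obtain ⟨u, hu⟩ := (Ideal.span_singleton_eq_span_singleton.mp hspan_eq)
    -- `x m * u = x (m+1)` in `S (m+2)`, `u` a unit, hence of value `1`
    have hu1 : O.valuation (((u : S (m + 2)) : K)) = 1 := by
      haveI : IsLocalRing (S (m + 2)) := hSloc (m + 2)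
      have hnot : ((u : S (m + 2))) ∉ IsLocalRing.maximalIdeal (S (m + 2)) := fun h =>
        (IsLocalRing.mem_maximalIdeal _).mp h u.isUnit
      have key : ∀ (T : Subring K) (hT : T = R (j (m + 3))) (w : T), (∃ _ : IsLocalRing T, w ∉ IsLocalRing.maximalIdeal T) →
          O.valuation (w : K) = 1 := by
        intro T hT w ⟨_, hw⟩
        subst hT
        have hle1 : O.valuation (w : K) ≤ 1 := (O.valuation_le_one_iff _).mpr ((hrunO (j (m + 3))).1 w.2)
        rcases hle1.lt_or_eq with hlt | heq
        · exact absurd ((hval (j (m + 3)) w).mpr hlt) hw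
        · exact heq
      exact key (S (m + 2)) (hSR (m + 2)) (u : S (m + 2)) ⟨hSloc (m + 2), hnot⟩
    have hKeq : ((x m : S (m + 1)) : K) * ((u : S (m + 2)) : K) = ((x (m + 1) : S (m + 2)) : K) := by
      have := congrArg (fun z : S (m + 2) => (z : K)) hu
      simpa using this
    rw [← hKeq, map_mul, hu1, mul_one]
  have hxv' : ∀ m, m₀ ≤ m → O.valuation ((x m : S (m + 1)) : K) = O.valuation ((x m₀ : S (m₀ + 1)) : K) := by
    intro m hm
    induction m, hm using Nat.le_induction with
    | base => rfl
    | succ m hm ih => rw [hxv m hm, ih]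
  -- ### the persistent parameter `x m₀`
  set x₀ : K := ((x m₀ : S (m₀ + 1)) : K) with hx₀def
  obtain ⟨⟨hx₀R, _, hx₀P⟩, hx₀0, -⟩ := hxout m₀
  have hx₀O : x₀ ∈ O := (hrunO (j (m₀ + 1))).1 hx₀R
  have hx₀v : O.valuation x₀ < 1 := by
    have := (hval (j (m₀ + 1)) ⟨x₀, hx₀R⟩).mp hx₀P
    exact this
  have hjle : ∀ m, m ≤ j m := fun m => hjmono.id_le m
  refine ⟨j (m₀ + 1), x₀, hx₀0, hx₀O, hx₀v,
    _root_.Summit.ResolutionOfSingularities.ResolutionOfSingularities.Theorems.SwitchingDichotomy.OddBranchPersistence.weakPersistence_of_pointSteps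
      (O := O) hbl hx₀0 (i₀ := j (m₀ + 1)) fun i hi => ?_⟩
  -- a visit `j (m+1) ≥ i` with `m ≥ m₀`
  have hm : m₀ ≤ i := le_trans (by have := hjle (m₀ + 1); omega) hi
  refine ⟨j (i + 1), by have := hjle (i + 1); have := hjmono.monotone (Nat.le_succ i); omega, ?_, ?_, ?_⟩
  · -- the centre of a point step contains every element of positive value
    intro y hy
    obtain ⟨_, hP⟩ := hjP (i + 1)
    rw [hP]
    exact (hval _ y).mpr hy
  · -- `x₀ ∈ P (j (i+1))`
    have hx₀Ri : x₀ ∈ R (j (i + 1)) := hmono (hjmono.monotone (by omega : m₀ + 1 ≤ i + 1)) hx₀R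
    refine ⟨hx₀Ri, ?_⟩
    obtain ⟨_, hP⟩ := hjP (i + 1)
    rw [hP]
    exact (hval _ ⟨x₀, hx₀Ri⟩).mpr hx₀v
  · -- maximal value on the centre: `v y ≤ v (x i) = v x₀`
    intro y hy
    obtain ⟨⟨hxiR, _, hxiP⟩, -, hximax⟩ := hxout i
    have h1 := hximax y ⟨hlocR _, by obtain ⟨_, hP⟩ := hjP (i + 1); rw [← hP]; exact hy⟩
    rw [hxv' i hm] at h1
    exact h1


/-- **(e3) glue PROVED: F-B♮ ⟸ (Σ) ∧ (e2) ∧ (e1)(2, 4)** through res-type-062's TREE theorem (p528129; not through the binder hFBp — tri-3 (G2a)); `hbl`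
read off `IsSteeredRun`. OURS. [folklore] -/
theorem strippingTailIsolatedConclTwoN_of_persist (hrecur : PointStepsRecurTwoN) (hPT : PointTailPersistTwoN)
    (hNT : NoTangentialTailHP 2 4) : StrippingTailIsolatedConclTwoN := by
  intro p hp2 k K _ _ _ _ _ O A₀ h₀ t core hrk R P s hR0 hN hrun hnd hhigh h2 hinf hiso
  have hNT' : NoTangentialTailHP p 4 := by
    subst hp2
    exact hNT
  exact _root_.Summit.ResolutionOfSingularities.ResolutionOfSingularities.Theorems.SwitchingDichotomy.OddBranchPersistence.concl_of_coreDatum_of_persistentTail_two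
    p hp2 O A₀ h₀ t core hrk R P hR0 (fun i => by obtain ⟨_, _, -, h, -⟩ := hrun.2 i; exact h)
    (hPT p hp2 k K O A₀ h₀ t core hrk R P s hR0 hN hrun hnd hhigh h2 hinf hiso hNT'
      (hrecur p hp2 k K O A₀ h₀ t core hrk R P s hR0 hN hrun hnd hhigh h2 hinf))

/-- **F-B ⟸ (Σ) ∧ (e2) ∧ hNT4 ∧ (Par-S)** — the shape slate11' consumes: F-B♮ by `strippingTailIsolatedConclTwoN_of_persist`, F-B-wild by the
(Par) fork with the (Par-P) leaf `strippingTailPersistentConclTwoN_holds` fed by name. Pure logic. OURS. [folklore] -/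
theorem strippingTailHighConclTwoN_of_persist_pieces (hrecur : PointStepsRecurTwoN) (hPT : PointTailPersistTwoN)
    (hNT4 : ∀ e : ℕ, 2 ≤ e → NoTangentialStepPerfect 2 4 (2 * e)) (hFBs : StrippingTailSwitchingConclTwoN) :
    StrippingTailHighConclTwoN :=
  strippingTailHighConclTwoN_of_fork (strippingTailIsolatedConclTwoN_of_persist hrecur hPT (noTangentialTailHP_two_four_of_pieces hNT4))
    (strippingTailWildConclTwoN_of_persistence_fork strippingTailPersistentConclTwoN_holds hFBs)

/-- **T-LINE slate11' (RULING 117a/118b: the line of record from r39)** = slate10' with (hrecur-inline, hG4) ↦ ((Σ) `hrecur : PointStepsRecurTwoN`,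
(e2) `hPT`, hNT4): T ⇐ FRONTIER {F-A1-toric `hB₂` · F-A2-toric `hC₂` · (Par-S) `hFBs` · W(3)₂ `hW3`} · RUNG {G-perf(3)₂ `hG3`} · WORK {(Σ) `hrecur`
(res-type-028) · (e2) `hPT` (res-D-pv-011) · hNT4 (res-D-pv-004 AS stub-10) · D3a `hD3a` (res-L0-w41-stub-3)} · FACTS {`hL'`, `hCP'`}. 11 binders; hA3 /
hD3c / (Par-P) fed by name. Pure logic. OURS. [folklore] -/
theorem eternalSteeredRunTwo_of_slate11'
    (hrecur : PointStepsRecurTwoN) (hPT : PointTailPersistTwoN)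
    (hNT4 : ∀ e : ℕ, 2 ≤ e → NoTangentialStepPerfect 2 4 (2 * e))
    (hFBs : StrippingTailSwitchingConclTwoN)
    (hB₂ : BirthWanderHighConclTwoN) (hC₂ : BranchWanderHighConclTwoN)
    (hG3 : ∀ e : ℕ, 2 ≤ e → NoEternalConstOrderIsolatedChainPerfect 2 3 (2 * e))
    (hW3 : ∀ e : ℕ, 2 ≤ e → NoEternalConstOrderIsolatedChainImperfect 2 3 (2 * e))
    (hD3a : LowTowerExistsTwo)
    (hL' : Literature.AlgebraicGeometry.Resolution.Lipman1978NoEternalNormalisedBranch.{0})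
    (hCP' : Literature.AlgebraicGeometry.Resolution.CossartPiltant2019LocalPermissible.{0}) : EternalSteeredRunTwo :=
  eternalSteeredRunTwo_of_slate2H₂ normalAtGeneratorTwo_holds noHeightOneCarrierTwo_holds finitelyHitThreadTwoN_holds hitHeightLtTwoN_holds
    (strippingTailHighConclTwoN_of_persist_pieces hrecur hPT hNT4 hFBs)
    hB₂ hC₂ strippedThreadTwoNH_holds
    (noEternalStrippedRadicandChainH_two_two_of_lipmanNormalised hL')
    (noEternalStrippedRadicandChainH_two_three_of_pieces hG3 hW3)
    (lowOrderTailConclTwoN_of_lipman lowOrderStep_holds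
      (lowRunTamedMixedBranchTwo_of_pieces' lowSurfaceStepExitsTwo_holds hD3a lowTowerPointStepsIOTwo_holds lowTowerTamingTwo_holds
        lowTowerSingularTwo_holds)
      tamedMixedBranchReduction_holds)
    hL'.toNormalBranch hL'.toValuativeQuadraticSequence hCP'

/-- (Σ) named = (Σ) inline: the `hrecur` binder of `eternalSteeredRunTwo_of_slate10'` IS `PointStepsRecurTwoN` up to unfolding, so res-type-028's leaf
`pointStepsRecurTwoN_holds : PointStepsRecurTwoN` feeds both slates. Pure logic. OURS. [folklore] -/
theorem eternalSteeredRunTwo_of_slate10'_named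
    (hrecur : PointStepsRecurTwoN) (hFBs : StrippingTailSwitchingConclTwoN)
    (hB₂ : BirthWanderHighConclTwoN) (hC₂ : BranchWanderHighConclTwoN)
    (hG4 : ∀ e : ℕ, 2 ≤ e → NoEternalConstOrderIsolatedChainPerfect 2 4 (2 * e))
    (hG3 : ∀ e : ℕ, 2 ≤ e → NoEternalConstOrderIsolatedChainPerfect 2 3 (2 * e))
    (hW3 : ∀ e : ℕ, 2 ≤ e → NoEternalConstOrderIsolatedChainImperfect 2 3 (2 * e))
    (hD3a : LowTowerExistsTwo)
    (hL' : Literature.AlgebraicGeometry.Resolution.Lipman1978NoEternalNormalisedBranch.{0})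
    (hCP' : Literature.AlgebraicGeometry.Resolution.CossartPiltant2019LocalPermissible.{0}) : EternalSteeredRunTwo :=
  eternalSteeredRunTwo_of_slate10' hrecur hFBs hB₂ hC₂ hG4 hG3 hW3 hD3a hL' hCP'



end SteeredTwo

end Summit.ResolutionOfSingularities.ResolutionOfSingularities.Theorems.SwitchingDichotomy.Words
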